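/-
b2b-lace packet, TAIL-BOUND ANALYST gen 10 (unit `b2b-lace-tail-g10`).  (S2b)-IMPR-L3 (S2)/(S3) with the x-space slot bounds
DISCHARGED: `NobleH1Step` ∘ `NobleH1XSpace` (lit-g18 M2).  Additive; nothing existing touched; d-generic; no numeral.
-/
import Literature.Probability.FitznerVanDerHofstad2017.NobleH1Step
import Literature.Probability.FitznerVanDerHofstad2017.NobleH1XSpace
import HarnessLib

/-!
# Literature.Probability.FitznerVanDerHofstad2017.NobleH1StepXSpace — Step 1 of [NoBLE17] §3.3.5, slot bounds discharged

`NobleH1Step.abs_integral_H1_diagram_le_boundH1_zero/_one` display the two-sided x-space bounds of the `m = 0, 1` slots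
(`hXup`, `hXlo`).  On the strict window `c_F + α_F + R̂_F(0) < 1` these are the theorems `integral_Cstar_pow_Mstar_le` /
`neg_le_integral_Cstar_pow_Mstar` of `NobleH1XSpace` (massive weighted line), so here they are discharged: the `hH1` binder of
`abs_nobleH_le_boundHD75_of_pieces` for `n = 0, 1` follows from `hKB`, the strict window, `1 ≤ α̲_F` and the DISPLAYED table
conditions (H-IM), (H-SC), (H-LOW), (H-IM1), (H-low1), (H-T) alone (packet DIVERGENCE D80; nothing decided here about the numerals).

Heartbeat census (packet filing rule): both declarations are term-mode applications (far below 100 000); no option set.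
-/

noncomputable section

open MeasureTheory Real
open Literature.Barriers.CriticalPhenomena
open Literature.Barriers.CriticalPhenomena.Slade2006Prop53 (P)
open Literature.Probability.LatticeModels

namespace Literature.Probability.FitznerVanDerHofstad2017

variable {d : ℕ} {cΦ αΦ cF αF : ℝ} {RΦ RF : Site d → ℝ} {r : F3Bounds.Args}

/-- **[NoBLE17] §3.3.5 Step 1, `n = 0`, Tables form, x-space bounds discharged**: for `2·3+1 ≤ d`, `KeyBounds r` on the cube off
`{D̂ = 1}`, the strict window, `1 ≤ α̲_F` and a table with (H-IM), (H-SC), (H-LOW) at `m = 0` and (H-IM1), (H-low1):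
`|∫ Ĥ₁ Ĝ⁰ D̂^l D̂^{(x)} dP/(2π)^d| ≤ F3Bounds.boundH1 τ 0 l x r`.
[cite: FitznerVanDerHofstad2016NoBLE, §3.3.5 (3.58)–(3.63), (3.71) pp. 1074–1077; FitznerVanDerHofstad2017, notebook General.nb In[2] BoundH[1]] -/
theorem abs_integral_H1_diagram_le_boundH1_zero_of_tables (hd : 2 * 3 + 1 ≤ d)
    (hKB : ∀ k ∈ cube d, Dhat d k < 1 → (lapAtomsAt d cΦ αΦ cF αF RΦ RF k).KeyBounds r)
    (hc0 : cF + αF + cosFT RF 0 < 1) (hα1 : 1 ≤ r.afmin) (τ : F3Bounds.Tables (Fin d → ℤ))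
    (hIM : ∀ j y, srwJ d 2 j y ≤ τ.IM 0 j y)
    (hSC : ∀ j y, srwI d 3 j y ≤ d * r.afmin * τ.IM 0 j y)
    (hLow : ∀ j y, (r.afmax - 1) * srwIShift2 d 3 j y ≤ 2 * (d : ℝ) ^ 2 * τ.IM 0 j y)
    (hIM1 : ∀ j y, srwI d 1 (j + 1) y + srwIShift2 d 2 j y / (2 * (d : ℝ) ^ 2 * r.afmin) ≤ τ.IM (-1) j y)
    (hLow1 : ∀ j y, srwI d 2 j y ≤ d * r.afmin * τ.IM (-1) j y) (l : ℕ) (x : Fin d → ℤ) :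
    |(∫ k, (lapAtomsAt d cΦ αΦ cF αF RΦ RF k).H1 * (lapAtomsAt d cΦ αΦ cF αF RΦ RF k).G ^ 0 *
        Dhat d k ^ l * DhatSym d x k ∂P d) / (2 * π) ^ d| ≤ F3Bounds.boundH1 τ 0 l x r := by
  have hα : 1 ≤ αF := hα1.trans (keyBounds_consts (by omega) hKB).1
  exact abs_integral_H1_diagram_le_boundH1_zero hd hKB hc0 hα1 τ
    (fun j y => integral_Cstar_pow_Mstar_le (cΦ := cΦ) (αΦ := αΦ) (RΦ := RΦ) (m := 0) (by omega) hc0 hα j y)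
    (fun j y => neg_le_integral_Cstar_pow_Mstar (cΦ := cΦ) (αΦ := αΦ) (RΦ := RΦ) (m := 0) (by omega) hc0 hα j y)
    hIM hSC hLow hIM1 hLow1 l x

/-- **[NoBLE17] §3.3.5 Step 1, `n = 1`, Tables form, x-space bounds discharged**: for `2·4+1 ≤ d`, `KeyBounds r` on the cube off
`{D̂ = 1}`, the strict window, `1 ≤ α̲_F` and a table with (H-IM), (H-SC), (H-LOW) at `m ≤ 1` and (H-T):
`|∫ Ĥ₁ Ĝ¹ D̂^l D̂^{(x)} dP/(2π)^d| ≤ F3Bounds.boundH1 τ 1 l x r`.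
[cite: FitznerVanDerHofstad2016NoBLE, §3.3.5 (3.58)–(3.66), (3.71) pp. 1074–1077; FitznerVanDerHofstad2017, notebook General.nb In[2] BoundH[1]] -/
theorem abs_integral_H1_diagram_le_boundH1_one_of_tables (hd : 2 * 4 + 1 ≤ d)
    (hKB : ∀ k ∈ cube d, Dhat d k < 1 → (lapAtomsAt d cΦ αΦ cF αF RΦ RF k).KeyBounds r)
    (hc0 : cF + αF + cosFT RF 0 < 1) (hα1 : 1 ≤ r.afmin) (τ : F3Bounds.Tables (Fin d → ℤ))
    (hIM : ∀ (m j : ℕ) (y : Fin d → ℤ), m ≤ 1 → srwJ d (m + 2) j y ≤ τ.IM m j y)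
    (hSC : ∀ (m j : ℕ) (y : Fin d → ℤ), m ≤ 1 → srwI d (m + 3) j y ≤ d * r.afmin * τ.IM m j y)
    (hLow : ∀ (m j : ℕ) (y : Fin d → ℤ), m ≤ 1 → (r.afmax - 1) * srwIShift2 d (m + 3) j y ≤ 2 * (d : ℝ) ^ 2 * τ.IM m j y)
    (hT : ∀ (m j : ℕ) (y : Fin d → ℤ), srwTS d r.afmin m j y ≤ τ.T m j y) (l : ℕ) (x : Fin d → ℤ) :
    |(∫ k, (lapAtomsAt d cΦ αΦ cF αF RΦ RF k).H1 * (lapAtomsAt d cΦ αΦ cF αF RΦ RF k).G ^ 1 *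
        Dhat d k ^ l * DhatSym d x k ∂P d) / (2 * π) ^ d| ≤ F3Bounds.boundH1 τ 1 l x r := by
  have hα : 1 ≤ αF := hα1.trans (keyBounds_consts (by omega) hKB).1
  exact abs_integral_H1_diagram_le_boundH1_one hd hKB hc0 hα1 τ
    (fun m j y hm => integral_Cstar_pow_Mstar_le (cΦ := cΦ) (αΦ := αΦ) (RΦ := RΦ) (m := m) (by omega) hc0 hα j y)
    (fun m j y hm => neg_le_integral_Cstar_pow_Mstar (cΦ := cΦ) (αΦ := αΦ) (RΦ := RΦ) (m := m) (by omega) hc0 hα j y)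
    hIM hSC hLow hT l x

end Literature.Probability.FitznerVanDerHofstad2017

end
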